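import Summits.QuantumFields.YangMills.Theses.UnitScaleTilt
import Literature.MathematicalPhysics.QuantumFieldTheory.Balaban1983to89.LatticeWordStokes

/-!
# Route `UnitScaleTilt` — crux K2 `HistoryTail` (stmt-QuantumFields-18916): THE CRUDE NON-ABELIAN LATTICE STOKES BOUND WITH LOCAL
# SMALLNESS — `|𝒰_x(w) − 1| ≤ (|w|²/4)·δ` for a closed word `w` when only the plaquettes cornered at the sites `walkEnd x v`, `|v| ≤ |w| + 2`,
# are within `δ` of `1`; and the (0.4) loop variables at a coarse bond under the same local hypothesis (support file; brick S3-loc₁ of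
# sub-lemma S3 of the split card)

Fleet lead `ym-ust-18916-p1` (gen 0); split card `CARD-18916-K2-split.md` (evidence #12/#16), remaining piece **S3-loc** (localisation of
the Stokes chain behind S3a–S3c).  The tree's Stokes bound `LatticeWordStokes.dist1_holAt_le_of_netDisp_eq_zero` and everything built on it
(`dist1_loopHol_le`, `AvgActionDefect.dist1_plaqHol_avgFun_le_mean_add`, this seat's `HistoryTailStokesStep`/`StokesIter`/`SmallFactor`) assume
`PlaqSmall δ U` on the WHOLE torus; in mechanism A of the K2 memo the configuration is the composite minimiser of a large-field history,
regular only AWAY from the history's large-field regions ([Balaban1985UV3] (68) p.273: «on B^j(Λ_j)»).  THIS FILE re-proves the Stokes bound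
from a LOCAL hypothesis that follows the walk: the adjacent-transposition calculus of `LatticeWordStokes` (§2–§4 there) only ever uses the
plaquette cornered at the current site `y = walkEnd x A` or at `y − e_a`, `y − e_b`, `y − e_a − e_b` (`= walkEnd x (A ++ [−a])`, …), and
every intermediate word of the cancellation algorithm is a prefix of a rearrangement of `w`, of length `≤ |w|`.  Hence:

* `dist1_holAt_le_of_netDisp_eq_zero_loc` — for a closed word `w` of length `n` from `x`: if `|U(∂q) − 1| ≤ δ` for every plaquette
  `q = ⟨walkEnd x v, a, b⟩` with `|v| ≤ n + 2`, then `|𝒰_x(w) − 1| ≤ (n²/4)·δ`;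
* `dist1_loopHol_le_loc` — the (0.4) loop variables at a coarse bond `c`: `|U(Γ ∪ [x,x′] ∪ (−Γ′) ∪ (−c)) − 1| ≤ (((d+2)L)²/4)·δ` when the
  plaquettes cornered at `walkEnd (emb c₋) v`, `|v| ≤ (d+2)L + 2`, are `δ`-small (the local twin of `LatticeWordStokes.dist1_loopHol_le`).
The site-arithmetic and word lemmas marked «adapted from LatticeWordStokes» are private there and re-derived here verbatim.

WHAT THIS IS NOT: the local twins of the correction-factor bounds and of the first-order coarse plaquette (`dist1_plaqHol_avgFun_le_mean_add`)
are the next bricks (S3-loc₂); nothing of (41)/(47); nothing uses (α).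
-/

noncomputable section

namespace Summit.QuantumFields.YangMills.Theorems.HistoryTailStokesLocal

open Literature.MathematicalPhysics.QuantumFieldTheory.Balaban1983to89
open T4Continuum T4ReflectionCone BlockAveraging
open LatticeWordStokes (holAt_walk_tt holAt_walk_tf holAt_walk_ft holAt_walk_ff swapDefect_eq_one_of_parallel holAt_walk_swap_eq
  holAt_walk_backtrack length_loopWord_le)

variable {P : Params} {j : ℕ} {G : Type*} [GaugeGroup G]

/-! ## §1 Site arithmetic (adapted from `LatticeWordStokes` §1, private there) -/

section Sites

/-- `(x − e_a) + e_a = x` (adapted from `LatticeWordStokes`, private there). [folklore] -/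
private theorem shift_unshift (x : Site P j) (a : Fin P.d) : (x.unshift a).shift a = x := by
  funext i
  by_cases h : i = a
  · subst h; simp [Site.shift, Site.unshift]
  · simp [Site.shift, Site.unshift, h]

/-- `(x + e_a) − e_a = x` (adapted from `LatticeWordStokes`, private there). [folklore] -/
private theorem unshift_shift (x : Site P j) (a : Fin P.d) : (x.shift a).unshift a = x := by
  funext i
  by_cases h : i = a
  · subst h; simp [Site.shift, Site.unshift]
  · simp [Site.shift, Site.unshift, h]

/-- `(x − e_a) − e_b = (x − e_b) − e_a` (adapted from `LatticeWordStokes`, private there). [folklore] -/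
private theorem unshift_unshift_comm (x : Site P j) (a b : Fin P.d) : (x.unshift a).unshift b = (x.unshift b).unshift a := by
  funext i
  by_cases ha : i = a <;> by_cases hb : i = b
  · subst ha; subst hb; rfl
  · subst ha; simp [Site.unshift, hb]
  · subst hb; simp [Site.unshift, ha]
  · simp [Site.unshift, ha, hb]

/-- `(x + e_a) − e_b = (x − e_b) + e_a` (adapted from `LatticeWordStokes`, private there). [folklore] -/
private theorem shift_unshift_comm (x : Site P j) (a b : Fin P.d) : (x.shift a).unshift b = (x.unshift b).shift a := by
  by_cases hab : a = b
  · subst hab; rw [unshift_shift, shift_unshift]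
  funext i
  by_cases ha : i = a <;> by_cases hb : i = b
  · exact absurd (ha.symm.trans hb) hab
  · subst ha; simp [Site.shift, Site.unshift, hb]
  · subst hb; simp [Site.shift, Site.unshift, ha]
  · simp [Site.shift, Site.unshift, ha, hb]

/-- `walkEnd x (v ++ [−a]) = (walkEnd x v) − e_a`. [folklore] -/
theorem walkEnd_append_neg (x : Site P j) (v : List (Letter P.d)) (a : Fin P.d) :
    walkEnd x (v ++ [(a, false)]) = (walkEnd x v).unshift a := by
  rw [walkEnd_append]; rfl

/-- `walkEnd x (v ++ [−a, −b]) = (walkEnd x v) − e_a − e_b`. [folklore] -/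
theorem walkEnd_append_neg_neg (x : Site P j) (v : List (Letter P.d)) (a b : Fin P.d) :
    walkEnd x (v ++ [(a, false), (b, false)]) = ((walkEnd x v).unshift a).unshift b := by
  rw [walkEnd_append]; rfl

end Sites

/-! ## §2 The swap defect at a site whose four lower corners carry small plaquettes -/

section Defect

variable (U : GaugeField P j G)

/-- `|hgh⁻¹ − 1| ≤ δ` and `|hg⁻¹h⁻¹ − 1| ≤ δ` from `|g − 1| ≤ δ`. [cite: Balaban1985Averaging, (19)-(20) p.21] -/
theorem dist1_conj_le {g z : G} (h : G) {δ : ℝ} (hg : dist1 g ≤ δ) (hz : z = h * g * h⁻¹ ∨ z = h * g⁻¹ * h⁻¹) : dist1 z ≤ δ := by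
  rcases hz with rfl | rfl
  · rwa [GaugeGroup.dist1_conj]
  · rwa [GaugeGroup.dist1_conj, GaugeGroup.dist1_inv]

/-- **THE SWAP DEFECT AT `y`, ORDERED NON-PARALLEL CASE, LOCAL HYPOTHESIS**: if the plaquettes `⟨z, a, b⟩` at the four corners
`z ∈ {y, y − e_a, y − e_b, y − e_a − e_b}` are within `δ` of `1`, so is `𝒰_y((a,s)(b,t))·𝒰_y((b,t)(a,s))⁻¹` (adapted from
`LatticeWordStokes.dist1_swapDefect_lt_of_lt`). [cite: Balaban1985Averaging, (9) p.19 and (19)-(20) p.21] -/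
theorem dist1_swapDefect_le_of_lt_loc {δ : ℝ} (y : Site P j) {a b : Fin P.d} (hab : a < b)
    (h0 : dist1 (GaugeField.plaqHol U ⟨y, a, b, hab⟩) ≤ δ)
    (ha : dist1 (GaugeField.plaqHol U ⟨y.unshift a, a, b, hab⟩) ≤ δ)
    (hb : dist1 (GaugeField.plaqHol U ⟨y.unshift b, a, b, hab⟩) ≤ δ)
    (hab' : dist1 (GaugeField.plaqHol U ⟨(y.unshift a).unshift b, a, b, hab⟩) ≤ δ) (s t : Bool) :
    dist1 (holAt U (walk y [(a, s), (b, t)]) * (holAt U (walk y [(b, t), (a, s)]))⁻¹) ≤ δ := by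
  cases s <;> cases t
  · -- (−a, −b): plaquette at y − a − b
    refine dist1_conj_le (U ⟨(y.unshift a).unshift b, a⟩ * U ⟨((y.unshift a).unshift b).shift a, b⟩)⁻¹ hab' (Or.inl ?_)
    rw [holAt_walk_ff, holAt_walk_ff]
    simp only [GaugeField.plaqHol]
    rw [unshift_unshift_comm y b a, shift_unshift _, show ((y.unshift a).unshift b).shift a = y.unshift b by
      rw [unshift_unshift_comm, shift_unshift]]
    group
  · -- (−a, +b): plaquette at y − a
    refine dist1_conj_le (U ⟨y.unshift a, a⟩)⁻¹ ha (Or.inr ?_)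
    rw [holAt_walk_ft, holAt_walk_tf]
    simp only [GaugeField.plaqHol]
    rw [shift_unshift, shift_unshift_comm y b a]
    group
  · -- (+a, −b): plaquette at y − b
    refine dist1_conj_le (U ⟨y.unshift b, b⟩)⁻¹ hb (Or.inr ?_)
    rw [holAt_walk_tf, holAt_walk_ft]
    simp only [GaugeField.plaqHol]
    rw [shift_unshift, shift_unshift_comm y a b]
    group
  · -- (+a, +b): the plaquette at y
    refine dist1_conj_le 1 h0 (Or.inl ?_)
    rw [holAt_walk_tt, holAt_walk_tt]
    simp only [GaugeField.plaqHol]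
    group

/-- The defect of `(m₂, m₁)` is the inverse of the defect of `(m₁, m₂)` (adapted from `LatticeWordStokes`, private there). [folklore] -/
private theorem swapDefect_symm (y : Site P j) (m₁ m₂ : Letter P.d) :
    holAt U (walk y [m₂, m₁]) * (holAt U (walk y [m₁, m₂]))⁻¹ = (holAt U (walk y [m₁, m₂]) * (holAt U (walk y [m₂, m₁]))⁻¹)⁻¹ := by
  group

variable (x : Site P j) (n : ℕ) {δ : ℝ}

/-- **THE SWAP DEFECT AT `walkEnd x v`, `|v| ≤ n`, UNDER THE WALK-LOCAL HYPOTHESIS** (every plaquette cornered at a site `walkEnd x v′`,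
`|v′| ≤ n + 2`, within `δ ≥ 0` of `1`): within `δ` of `1`. [cite: Balaban1985Averaging, (9) p.19 and (19)-(20) p.21] -/
theorem dist1_swapDefect_le_loc (hδ : 0 ≤ δ)
    (hU : ∀ v : List (Letter P.d), v.length ≤ n + 2 →
      ∀ (a b : Fin P.d) (h : a < b), dist1 (GaugeField.plaqHol U ⟨walkEnd x v, a, b, h⟩) ≤ δ)
    (v : List (Letter P.d)) (hv : v.length ≤ n) (m₁ m₂ : Letter P.d) :
    dist1 (holAt U (walk (walkEnd x v) [m₁, m₂]) * (holAt U (walk (walkEnd x v) [m₂, m₁]))⁻¹) ≤ δ := by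
  -- the four corner bounds at `y = walkEnd x v`
  have hc : ∀ (a b : Fin P.d) (h : a < b),
      dist1 (GaugeField.plaqHol U ⟨walkEnd x v, a, b, h⟩) ≤ δ ∧
      dist1 (GaugeField.plaqHol U ⟨(walkEnd x v).unshift a, a, b, h⟩) ≤ δ ∧
      dist1 (GaugeField.plaqHol U ⟨(walkEnd x v).unshift b, a, b, h⟩) ≤ δ ∧
      dist1 (GaugeField.plaqHol U ⟨((walkEnd x v).unshift a).unshift b, a, b, h⟩) ≤ δ := by
    intro a b h
    refine ⟨hU v (by omega) a b h, ?_, ?_, ?_⟩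
    · have := hU (v ++ [(a, false)]) (by simp; omega) a b h
      rwa [walkEnd_append_neg] at this
    · have := hU (v ++ [(b, false)]) (by simp; omega) a b h
      rwa [walkEnd_append_neg] at this
    · have := hU (v ++ [(a, false), (b, false)]) (by simp; omega) a b h
      rwa [walkEnd_append_neg_neg] at this
  obtain ⟨a, s⟩ := m₁
  obtain ⟨b, t⟩ := m₂
  rcases lt_trichotomy a b with hab | rfl | hba
  · obtain ⟨h0, ha, hb, hab'⟩ := hc a b hab
    exact dist1_swapDefect_le_of_lt_loc U (walkEnd x v) hab h0 ha hb hab' s t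
  · rw [swapDefect_eq_one_of_parallel, GaugeGroup.dist1_one]; exact hδ
  · obtain ⟨h0, ha, hb, hab'⟩ := hc b a hba
    rw [← inv_inv (holAt U (walk (walkEnd x v) [(a, s), (b, t)]) * (holAt U (walk (walkEnd x v) [(b, t), (a, s)]))⁻¹),
      GaugeGroup.dist1_inv, ← swapDefect_symm]
    exact dist1_swapDefect_le_of_lt_loc U (walkEnd x v) hba h0 ha hb hab' t s

/-- **AN ADJACENT TRANSPOSITION AFTER A PREFIX OF LENGTH `≤ n` COSTS AT MOST `δ`** (local hypothesis).
[cite: Balaban1985Averaging, (19)-(20) p.21] -/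
theorem dist1_holAt_swap_le_loc (hδ : 0 ≤ δ)
    (hU : ∀ v : List (Letter P.d), v.length ≤ n + 2 →
      ∀ (a b : Fin P.d) (h : a < b), dist1 (GaugeField.plaqHol U ⟨walkEnd x v, a, b, h⟩) ≤ δ)
    (A C : List (Letter P.d)) (hA : A.length ≤ n) (m₁ m₂ : Letter P.d) :
    dist1 (holAt U (walk x (A ++ m₁ :: m₂ :: C))) ≤ δ + dist1 (holAt U (walk x (A ++ m₂ :: m₁ :: C))) := by
  rw [holAt_walk_swap_eq U x A C m₁ m₂]
  refine (GaugeGroup.dist1_mul_le _ _).trans ?_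
  rw [GaugeGroup.dist1_conj]
  exact add_le_add (dist1_swapDefect_le_loc U x n hδ hU A hA m₁ m₂) le_rfl

/-- **MOVING `m̄` LEFTWARD THROUGH `B` TO ITS PARTNER `m` COSTS `|B|` PLAQUETTES** (local hypothesis; `|A| + |B| ≤ n`).
[cite: Balaban1985Averaging, (19)-(20) p.21] -/
theorem dist1_holAt_cancel_le_loc (hδ : 0 ≤ δ)
    (hU : ∀ v : List (Letter P.d), v.length ≤ n + 2 →
      ∀ (a b : Fin P.d) (h : a < b), dist1 (GaugeField.plaqHol U ⟨walkEnd x v, a, b, h⟩) ≤ δ)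
    (m : Letter P.d) :
    ∀ (B A C : List (Letter P.d)), A.length + B.length ≤ n →
      dist1 (holAt U (walk x (A ++ m :: (B ++ m.flip :: C)))) ≤ (B.length : ℝ) * δ + dist1 (holAt U (walk x (A ++ (B ++ C))))
  | [], A, C, _ => by
    simp only [List.nil_append, List.length_nil, Nat.cast_zero, zero_mul, zero_add]
    rw [holAt_walk_backtrack]
  | b :: B, A, C, hAB => by
    have h₁ : A ++ b :: m :: (B ++ m.flip :: C) = (A ++ [b]) ++ m :: (B ++ m.flip :: C) := by simp
    have h₂ : A ++ (b :: B ++ C) = (A ++ [b]) ++ (B ++ C) := by simp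
    have hA : A.length ≤ n := by simp only [List.length_cons] at hAB; omega
    have hAb : (A ++ [b]).length + B.length ≤ n := by simp only [List.length_cons] at hAB; simp; omega
    calc dist1 (holAt U (walk x (A ++ m :: (b :: B ++ m.flip :: C))))
        ≤ δ + dist1 (holAt U (walk x (A ++ b :: m :: (B ++ m.flip :: C)))) := dist1_holAt_swap_le_loc U x n hδ hU A _ hA m b
      _ ≤ δ + ((B.length : ℝ) * δ + dist1 (holAt U (walk x (A ++ (b :: B ++ C))))) := by
          rw [h₁, h₂]
          exact add_le_add le_rfl (dist1_holAt_cancel_le_loc hδ hU m B (A ++ [b]) C hAb)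
      _ = ((b :: B).length : ℝ) * δ + dist1 (holAt U (walk x (A ++ (b :: B ++ C)))) := by
          simp only [List.length_cons, Nat.cast_succ]
          ring

end Defect

/-! ## §3 The bound for closed words under the walk-local hypothesis -/

section Main

variable (U : GaugeField P j G)

/-- A word with positive (negative) net displacement along `a` contains `+e_a` (`−e_a`) (adapted from `LatticeWordStokes`, private there). [folklore] -/
private theorem mem_of_netDisp_ne (a : Fin P.d) : ∀ (w : List (Letter P.d)),
    (0 < netDisp w a → (a, true) ∈ w) ∧ (netDisp w a < 0 → (a, false) ∈ w)
  | [] => by simp [netDisp]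
  | l :: w => by
    obtain ⟨hpos, hneg⟩ := mem_of_netDisp_ne a w
    obtain ⟨b, s⟩ := l
    constructor
    · intro h
      rw [netDisp_cons] at h
      by_cases hb : b = a
      · subst hb
        cases s
        · exact List.mem_cons_of_mem _ (hpos (by simp at h; linarith))
        · exact List.mem_cons_self
      · exact List.mem_cons_of_mem _ (hpos (by simp [hb] at h; exact h))
    · intro h
      rw [netDisp_cons] at h
      by_cases hb : b = a
      · subst hb
        cases s
        · exact List.mem_cons_self
        · exact List.mem_cons_of_mem _ (hneg (by simp at h; linarith))
      · exact List.mem_cons_of_mem _ (hneg (by simp [hb] at h; exact h))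

/-- The tail of a closed word beginning with `m` contains `m̄` (adapted from `LatticeWordStokes`, private there). [folklore] -/
private theorem flip_mem_of_netDisp_eq_zero (m : Letter P.d) (w : List (Letter P.d)) (h : netDisp (m :: w) m.1 = 0) :
    m.flip ∈ w := by
  obtain ⟨a, s⟩ := m
  rw [netDisp_cons] at h
  simp only [if_true] at h
  cases s
  · exact (mem_of_netDisp_ne a w).1 (by simp at h; linarith)
  · exact (mem_of_netDisp_ne a w).2 (by simp at h; linarith)

/-- Removing a cancelling pair keeps every net displacement (adapted from `LatticeWordStokes`, private there). [folklore] -/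
private theorem netDisp_remove_pair (m : Letter P.d) (B C : List (Letter P.d)) (ν : Fin P.d) :
    netDisp (m :: (B ++ m.flip :: C)) ν = netDisp (B ++ C) ν := by
  obtain ⟨a, s⟩ := m
  simp only [netDisp_cons, netDisp_append, Letter.flip]
  by_cases ha : a = ν
  · subst ha; cases s <;> simp <;> ring
  · simp [ha]

/-- **THE CRUDE NON-ABELIAN LATTICE STOKES BOUND WITH WALK-LOCAL SMALLNESS.**  For every base site `x` and `δ ≥ 0`: if every plaquette
`⟨walkEnd x v, a, b⟩` with `|v| ≤ n + 2` is within `δ` of `1`, then every closed word `w` of length `n` has `|𝒰_x(w) − 1| ≤ (n²/4)·δ`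
(the proof of `LatticeWordStokes.dist1_holAt_le_of_netDisp_eq_zero`, with the plaquettes it touches tracked).
[cite: Balaban1985Averaging, (9) p.19 and (19)-(20) p.21] -/
theorem dist1_holAt_le_of_netDisp_eq_zero_loc (x : Site P j) {δ : ℝ} (hδ : 0 ≤ δ) :
    ∀ (n : ℕ), (∀ v : List (Letter P.d), v.length ≤ n + 2 →
        ∀ (a b : Fin P.d) (h : a < b), dist1 (GaugeField.plaqHol U ⟨walkEnd x v, a, b, h⟩) ≤ δ) →
      ∀ (w : List (Letter P.d)), w.length = n → (∀ ν, netDisp w ν = 0) →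
        dist1 (holAt U (walk x w)) ≤ ((n : ℝ) ^ 2 / 4) * δ := by
  intro n
  induction n using Nat.strong_induction_on with
  | _ n ih =>
    intro hU w hlen hnull
    cases w with
    | nil =>
      subst hlen
      simp only [walk, holAt_nil, GaugeGroup.dist1_one]
      positivity
    | cons m w' =>
      have hmem : m.flip ∈ w' := flip_mem_of_netDisp_eq_zero m w' (hnull m.1)
      obtain ⟨B, C, hw'⟩ := List.append_of_mem hmem
      subst hw'
      simp only [List.length_cons, List.length_append] at hlen
      have hBn : ([] : List (Letter P.d)).length + B.length ≤ n := by simp; omega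
      have hstep := dist1_holAt_cancel_le_loc U x n hδ hU m B [] C hBn
      simp only [List.nil_append] at hstep
      have hnull' : ∀ ν, netDisp (B ++ C) ν = 0 := fun ν => by rw [← netDisp_remove_pair m B C ν]; exact hnull ν
      have hlen' : (B ++ C).length = n - 2 := by simp; omega
      have h2n : 2 ≤ n := by omega
      have hU' : ∀ v : List (Letter P.d), v.length ≤ (n - 2) + 2 →
          ∀ (a b : Fin P.d) (h : a < b), dist1 (GaugeField.plaqHol U ⟨walkEnd x v, a, b, h⟩) ≤ δ :=
        fun v hv a b h => hU v (by omega) a b h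
      have ih' := ih (n - 2) (by omega) hU' (B ++ C) hlen' hnull'
      have hB : (B.length : ℝ) ≤ (n : ℝ) - 2 := by
        have h : (B.length : ℝ) + 2 ≤ n := by exact_mod_cast (show B.length + 2 ≤ n by omega)
        linarith
      have hcast : (((n - 2 : ℕ) : ℝ)) = (n : ℝ) - 2 := by rw [Nat.cast_sub h2n]; norm_num
      calc dist1 (holAt U (walk x (m :: (B ++ m.flip :: C))))
          ≤ (B.length : ℝ) * δ + dist1 (holAt U (walk x (B ++ C))) := hstep
        _ ≤ ((n : ℝ) - 2) * δ + ((((n - 2 : ℕ) : ℝ)) ^ 2 / 4) * δ := add_le_add (mul_le_mul_of_nonneg_right hB hδ) ih'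
        _ ≤ ((n : ℝ) ^ 2 / 4) * δ := by rw [hcast]; nlinarith

/-- The same bound with the hypothesis radius any `N ≥ |w|`: plaquettes cornered at `walkEnd x v`, `|v| ≤ N + 2`, small ⇒
`|𝒰_x(w) − 1| ≤ (|w|²/4)·δ`. [cite: Balaban1985Averaging, (9) p.19 and (19)-(20) p.21] -/
theorem dist1_holAt_le_loc (x : Site P j) {δ : ℝ} (hδ : 0 ≤ δ) {N : ℕ}
    (hU : ∀ v : List (Letter P.d), v.length ≤ N + 2 →
      ∀ (a b : Fin P.d) (h : a < b), dist1 (GaugeField.plaqHol U ⟨walkEnd x v, a, b, h⟩) ≤ δ)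
    (w : List (Letter P.d)) (hwN : w.length ≤ N) (hw : ∀ ν, netDisp w ν = 0) :
    dist1 (holAt U (walk x w)) ≤ ((w.length : ℝ) ^ 2 / 4) * δ :=
  dist1_holAt_le_of_netDisp_eq_zero_loc U x hδ w.length (fun v hv a b h => hU v (by omega) a b h) w rfl hw

end Main

/-! ## §4 The loop variables of the (0.4) block averaging under the walk-local hypothesis -/

section Loops

variable (U : GaugeField P j G)

/-- **THE (0.4) LOOP VARIABLES ARE SMALL WHERE THE FIELD IS SMALL NEAR THE BLOCK** (local twin of `LatticeWordStokes.dist1_loopHol_le`):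
if every plaquette cornered at a site `walkEnd (emb c₋) v`, `|v| ≤ (d+2)L + 2`, is within `δ ≥ 0` of `1`, then every loop variable
`U(Γ ∪ [x,x′] ∪ (−Γ′) ∪ (−c))` at the coarse bond `c` is within `(((d+2)L)²/4)·δ` of `1`. [cite: Balaban1987RG1, (0.4) p.253] -/
theorem dist1_loopHol_le_loc {δ : ℝ} (hδ : 0 ≤ δ) (c : PBond P (j + 1))
    (hU : ∀ v : List (Letter P.d), v.length ≤ (P.d + 2) * P.L + 2 →
      ∀ (a b : Fin P.d) (h : a < b), dist1 (GaugeField.plaqHol U ⟨walkEnd (emb c.src) v, a, b, h⟩) ≤ δ)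
    (i : Idx P) :
    dist1 (loopHol U c i) ≤ ((((P.d + 2) * P.L : ℕ) : ℝ) ^ 2 / 4) * δ := by
  have hlen := length_loopWord_le c i
  have h := dist1_holAt_le_loc U (emb c.src) hδ hU (loopWord P.L c.dir (off i.1) i.2.1 i.2.2) hlen
    (netDisp_loopWord _ _ _ _ _)
  refine h.trans (mul_le_mul_of_nonneg_right ?_ hδ)
  have hlen' : ((loopWord P.L c.dir (off i.1) i.2.1 i.2.2).length : ℝ) ≤ (((P.d + 2) * P.L : ℕ) : ℝ) := by
    exact_mod_cast hlen
  have h0 : (0 : ℝ) ≤ ((loopWord P.L c.dir (off i.1) i.2.1 i.2.2).length : ℝ) := Nat.cast_nonneg _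
  nlinarith

end Loops

end Summit.QuantumFields.YangMills.Theorems.HistoryTailStokesLocal

end
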